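import Literature.Analysis.FluidPDE.Ferrari1993EnergyInequalityReduction
import Literature.Analysis.FluidPDE.PeriodicCylinderWithinCalculus
import Literature.Analysis.FluidPDE.ConvectCommutatorCalculus
import HarnessLib

/-!
# The Neumann problem for the Euler pressure in the periodic cylinder (Ferrari 1993, Lemma 2,
(10)–(12))

Topic `Literature/Analysis/FluidPDE`. Support file (all results proved, no named facts, no
definitions). First file of the decomposition of the named fact
`Literature.Analysis.FluidPDE.Ferrari1993_periodicCylinderPressureEstimate`
(`Ferrari1993EnergyInequalityReduction.lean`; A. B. Ferrari, Comm. Math. Phys. **155** (1993),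
Lemma 2, pp. 280–281: "If `u ∈ H^s(Ω)` and `p ∈ H^{s+1}(Ω)`, `s ≥ 3`," solve the Euler equations
(1)–(3), "then `|∇p|_{H^s} ≤ C |u|_{W^{1,∞}} |u|_{H^s}`"). The printed proof ("a modification of an
argument in [14]" — Temam 1975) has three steps:

1. **The Neumann problem** (p. 281): "we first take the divergence of (1) and the dot product of
   the same with `n = (n₁, n₂, n₃)`, and use (2) and (3) to obtain the following Neumann problem
   for `p`: (10) `Δp = −Σ_{i,j} ∂ᵢuⱼ ∂ⱼuᵢ` in `Ω`, (11) `∂p/∂n = −Σ_{i,j} uᵢ (∂ᵢuⱼ) nⱼ` on `∂Ω`.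
   The derivative of `u` on the right side of (11) may be eliminated by representing `∂Ω`
   locally as a smooth function `φ(x) = 0` … so that on each local patch of `∂Ω` (11) becomes
   (12) `∂p/∂n = −Σ uᵢuⱼψᵢⱼ`, where `ψᵢⱼ = ∂ᵢ∂ⱼφ/|∇φ|`."
2. **The standard estimate** (p. 281): "We estimate `∇p` by applying the Trace theorem and the
   first part of Lemma 1 to a standard estimate of `∇p`, derived by the usual method of choosing
   a partition of unity for `Ω`, deriving local estimates from (10) and (12), and combining them
   for the global estimate:
   `|∇p|_{H^s(Ω)} ≤ C(|Σ ∂ᵢuⱼ∂ⱼuᵢ|_{H^{s−1}(Ω)} + Σ |uᵢuⱼψᵢⱼ|_{H^{s−1/2}(∂Ω)}) ≤ … ≤ C |u|_{W^{1,∞}} |u|_{H^s}`,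
   the boundary spaces `W^{s−1/p,p}(∂Ω)` being *defined* (p. 278) as the restrictions to `∂Ω` of
   `W^{s,p}(Ω)` functions, normed by the infimum of `|F|_{W^{s,p}(Ω)}` over all extensions `F`.
3. **The products** (Lemma 1 i), p. 280).

This file **proves step 1** in the tree's smooth periodic class
`IsPeriodicCylinderEulerSolution L [0, T) u₀ u p` (classical Euler solution in the cylinder
`{r < 1}` with the slip condition on `{r = 1}`, `C^∞` up to the wall jointly in `(t, x)`,
`L`-periodic in `z`), for the geometry of the cylinder (`φ = (x₀² + x₁² − 1)/2`, `|∇φ| = 1` and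
`ψᵢⱼ = δᵢⱼ` (`i, j ≤ 1`) on the wall, so that (12) reads `∂p/∂n = u₀² + u₁²` with the outward normal
`n = e_r`):

* `IsPeriodicCylinderEulerSolution.cylLap_pressure_eq` — **(10) up to the wall**: for every
  `t ∈ [0, T)` and every `x` of the *closed* cylinder, `Δ_K p(t) (x) = −tr(D_K u(t)(x) ∘ D_K u(t)(x))`
  (`= −Σᵢⱼ ∂ᵢuⱼ∂ⱼuᵢ`), with the Laplacian and the derivatives taken within the closed cylinder
  (`cylLap`, `fderivWithin`; `PeriodicCylinderWithinCalculus.lean`); and its classical form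
  `laplacian_pressure_eq` in the open cylinder (`Δ p(t) = −tr(Du(t) ∘ Du(t))`, Mathlib's Laplacian
  and Fréchet derivative). Proof: at interior times and interior points, `Δp = div ∇p`,
  `∇p = −∂ₜu − (u·∇)u` (momentum), `div ∂ₜu = ∂ₜ div u = 0` (the time derivative within `[0, T)`
  commutes with spatial derivatives of the jointly smooth velocity,
  `timeDerivWithin_spaceDerivWithin`) and `div((u·∇)u) = tr(Du ∘ Du) + (u·∇)(div u) = tr(Du ∘ Du)`
  (`divergence_convect_self_eq_trace`, from `∂ₑ((u·∇)u) = (∂ₑu·∇)u + (u·∇)∂ₑu`); both sides are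
  continuous on `[0, T) × {r ≤ 1}`, which lies in the closure of `(0, T) × {r < 1}`.
* `IsPeriodicCylinderEulerSolution.neumann_pressure_eq` — **(11)–(12)**: for every `t ∈ [0, T)`
  and every `x` of the wall `{r = 1}`, `∂p(t)/∂n (x) = D_K p(t)(x)(e_r(x)) = u₀(t,x)² + u₁(t,x)²`.
  Proof: the momentum equation extends to the closed cylinder by continuity
  (`momentum_closure`); on the wall `⟪∂ₜu, e_r⟫ = ∂ₜ⟪u, e_r⟫ = 0` by the slip condition, and
  `⟪D_K u (u), e_r⟫ = −(u₀² + u₁²)` (`inner_fderivWithin_apply_self_eR`): the function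
  `⟪u, x_h⟫`, `x_h = (x₀, x₁, 0)`, vanishes on the wall and `u` is tangential there, so its
  derivative along `u` vanishes (`cylDeriv_eq_zero_of_wall_of_tangent`), while
  `∂_u ⟪u, x_h⟫ = ⟪D_K u (u), x_h⟩ + ⟪u, u_h⟫` and `x_h = e_r` on the wall.

Steps 2–3 and the assembly are the subject of the sibling files of this decomposition (the
product estimates of step 3 by the Leibniz rule and the tree's `L⁴` Gagliardo–Nirenberg
inequality on the cell, `PeriodicCylinderGagliardoNirenberg.lean`; the standard Neumann estimate
of step 2 — in Ferrari's own form, with the boundary norm of p. 278 defined through extensions,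
`|∇q|_{H³(cell)} ≤ C(|Δq|_{H²(cell)} + |G|_{H³(cell)})` whenever `∂q/∂n = G` on the wall for
`q`, `G` smooth on the closed cylinder and `L`-periodic — as an a-priori estimate for smooth
periodic functions on the cylinder: Green's identities on the period cell, the Poincaré–Wirtinger
and trace inequalities, tangential derivatives along the Killing fields `∂_θ`, `∂_z` of the wall
and the polar identity of `PeriodicCylinderWithinCalculus.lean`). The two theorems of this file
are the form in which that estimate is consumed: `q = p(t)`, `Δ_K q = −tr(D_K u ∘ D_K u)` smooth
on the closed cylinder, and `G = u₀² + u₁²` (`contDiffOn_neumannDatum`: smooth on the closed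
cylinder and `L`-periodic — periodicity of the datum, not only of the pressure, matters for the
estimate across the seam `z ≡ 0` of the period cell).

## Faithfulness / what is NOT here

* Nothing is vendored here (no named facts, no definitions). The statements are rendered in the
  tree's smooth periodic class, for the cylinder `{r < 1} × ℝ/Lℤ` (Ferrari: a bounded smooth
  domain of `ℝ³`; adaptation caveat of the chain as in `Ferrari1993_periodicCylinderPressureEstimate`,
  Luo–Hou 2014 §4.4, Chen–Hou 2021 §9); the sign of (12) is that of the outward normal `e_r`
  (`∂p/∂n = +(u₀² + u₁²)`, the centripetal pressure gradient of a flow along the wall).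
* Not here: steps 2–3 of the printed proof (see above).

Mathlib/tree search: no pressure Poisson / Neumann condition for Euler solutions on domains with
boundary in the tree (`lean search 'laplacian_pressure|Neumann|neumann'`: whole-space and torus
pressure Poisson equations — `IsLerayProfile.laplacian_pressure_eq`, `divergence_convect_self_eq`
(global `C²`, globally divergence free), `EulerReynoldsPressure` — and quantum many-body Neumann
energies only). Used: `cylDeriv`, `cylGrad`, `cylLap`,
`cylDeriv_eq_zero_of_wall_of_tangent`, `divergence_gradient_eq_cylLap`, `inner_cylGrad_left`
(`PeriodicCylinderWithinCalculus`); `timeDerivWithin_spaceDerivWithin`, `spaceDerivWithin`,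
`contDiffOn_uncurry_spaceDerivWithin` (`IteratedSliceDerivatives`); `fderiv_convect_apply_eqOn`
(`ConvectCommutatorCalculus`); `timeDerivWithin_eq_fderivWithin_uncurry`,
`hasDerivWithinAt_time_fderivWithin`, `continuousOn_uncurry_timeDerivWithin`
(`SpaceTimeSliceCalculus`); from Mathlib `LinearMap.trace_eq_sum_inner`,
`InnerProductSpace.laplacian_eq_iteratedFDerivWithin_orthonormalBasis`, `iteratedFDeriv_two_apply`,
`fderiv_clm_apply`, `Set.EqOn.of_subset_closure`, `closure_prod_eq`, `closure_Ioo`,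
`UniqueDiffWithinAt.eq_deriv`, `HasDerivWithinAt.inner`.

## References

* A. B. Ferrari, *On the blow-up of solutions of the 3-D Euler equations in a bounded domain*,
  Comm. Math. Phys. 155 (1993) 277–294, Lemma 2 and (10)–(12), pp. 280–281; p. 278 (boundary
  Sobolev spaces by extension). [Ferrari1993]
* R. Temam, *On the Euler equations of incompressible perfect fluids*, J. Funct. Anal. 20 (1975)
  32–43, §1 ((1.2)–(1.3): the Neumann problem for `π`, "by the classical results of regularity for
  the Neuman problem (Agmon–Douglis–Nirenberg)"). [Temam1975]
* T. Kato, C. Y. Lai, J. Funct. Anal. 56 (1984) 15–28, §4 (4.4) (the pressure estimate with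
  `H^{s₀}` in place of `W^{1,∞}`). [KatoLai1984]
-/

noncomputable section

open MeasureTheory Set Function Filter Topology TopologicalSpace WithLp
open scoped ContDiff NNReal ENNReal InnerProductSpace RealInnerProductSpace Laplacian

namespace Literature.Analysis.FluidPDE

open Literature.Analysis.FunctionSpaces

/-- Local notation for physical space `ℝ³ = EuclideanSpace ℝ (Fin 3)`. -/
local notation "ℝ³" => EuclideanSpace ℝ (Fin 3)

/-- Local notation for the closed unit cylinder `{r ≤ 1}`. -/
local notation "𝕂" => closure (SetLike.coe unitCylinder : Set (EuclideanSpace ℝ (Fin 3)))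

/-! ### Calculus: the Laplacian within, and the divergence of the convective derivative -/

section Calculus

variable {F' : Type*} [NormedAddCommGroup F'] [NormedSpace ℝ F']

/-- **On the open cylinder Mathlib's Laplacian is the Laplacian within the closed cylinder**,
`Δ f (x) = Σᵢ ∂ᵢ∂ᵢ f (x) = cylLap f x`, for `f` smooth on the closed cylinder (the standard basis is
orthonormal; `D(∂ᵢ f)(x) eᵢ = D²f(x)(eᵢ, eᵢ)`). [folklore] -/
theorem laplacian_eq_cylLap {f : ℝ³ → F'} (hf : ContDiffOn ℝ ∞ f 𝕂) {x : ℝ³}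
    (hx : x ∈ (unitCylinder : Set ℝ³)) : (Δ f) x = cylLap f x := by
  have hU : IsOpen (unitCylinder : Set ℝ³) := unitCylinder.isOpen
  have hfU : ContDiffOn ℝ ∞ f (unitCylinder : Set ℝ³) := hf.mono subset_closure
  have hD : ContDiffOn ℝ ∞ (fderiv ℝ f) (unitCylinder : Set ℝ³) :=
    ((contDiffOn_infty_iff_fderiv_of_isOpen hU).1 hfU).2
  have hDd : DifferentiableAt ℝ (fderiv ℝ f) x := differentiableAt_of_contDiffOn_isOpen hU hD hx
  have hΔ := congrFun (InnerProductSpace.laplacian_eq_iteratedFDeriv_orthonormalBasis f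
    (EuclideanSpace.basisFun (Fin 3) ℝ)) x
  rw [hΔ, cylLap_apply]
  refine Finset.sum_congr rfl fun i _ => ?_
  rw [iteratedFDeriv_two_apply, cylDeriv_eq_fderiv _ _ hx]
  have hev : cylDeriv (fun _ => cylBasis i) f =ᶠ[𝓝 x] fun y => fderiv ℝ f y (cylBasis i) :=
    Filter.eventuallyEq_of_mem (hU.mem_nhds hx) fun y hy => cylDeriv_eq_fderiv _ _ hy
  rw [hev.fderiv_eq, fderiv_clm_apply hDd (differentiableAt_const _)]
  simp [EuclideanSpace.basisFun_apply, cylBasis]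

variable {E : Type*} [NormedAddCommGroup E] [InnerProductSpace ℝ E] [FiniteDimensional ℝ E]

/-- **`div((v·∇)v) = tr(Dv ∘ Dv)` for a divergence-free field**, local version: if `v` is `C^∞`
on an open set `U` and `div v = 0` on `U`, then at every `x ∈ U`,
`div((v·∇)v)(x) = tr(Dv(x) ∘ Dv(x))` (`= Σᵢⱼ ∂ᵢvⱼ ∂ⱼvᵢ`). Proof: in an orthonormal frame,
`∂ₑ((v·∇)v) = (∂ₑv·∇)v + (v·∇)∂ₑv` (`fderiv_convect_apply_eqOn`), so
`div((v·∇)v) = Σᵢ ⟪eᵢ, Dv(Dv eᵢ)⟫ + Σᵢ ⟪eᵢ, D(∂ᵢv)(v)⟫ = tr(Dv ∘ Dv) + D(div v)(v)`, and `div v`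
vanishes identically near `x` (Ferrari 1993, (10); Temam 1975, (1.2)). [folklore] -/
theorem divergence_convect_self_eq_trace {U : Set E} (hU : IsOpen U) {v : E → E}
    (hv : ContDiffOn ℝ ∞ v U) (hdiv : ∀ y ∈ U, VectorCalculus.divergence v y = 0) {x : E}
    (hx : x ∈ U) :
    VectorCalculus.divergence (convect v v) x =
      LinearMap.trace ℝ E ((fderiv ℝ v x).comp (fderiv ℝ v x) : E →ₗ[ℝ] E) := by
  set b := stdOrthonormalBasis ℝ E with hb
  have hDi : ∀ i, ContDiffOn ℝ ∞ (fun y => fderiv ℝ v y (b i)) U := fun i =>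
    contDiffOn_fderiv_apply_of_isOpen hU hv (b i)
  have hdi : ∀ i, DifferentiableAt ℝ (fun y => fderiv ℝ v y (b i)) x := fun i =>
    differentiableAt_of_contDiffOn_isOpen hU (hDi i) hx
  -- the derivative of the convective term along each frame vector
  have h1 : ∀ i, fderiv ℝ (convect v v) x (b i) =
      fderiv ℝ v x (fderiv ℝ v x (b i)) + fderiv ℝ (fun y => fderiv ℝ v y (b i)) x (v x) := by
    intro i
    have h := fderiv_convect_apply_eqOn hU hv hv (b i) hx
    simpa only [convect_apply] using h
  -- the second sum is the derivative of `div v` along `v x`, which vanishes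
  have h2 : ∑ i, ⟪b i, fderiv ℝ (fun y => fderiv ℝ v y (b i)) x (v x)⟫ =
      fderiv ℝ (fun y => ∑ i, ⟪b i, fderiv ℝ v y (b i)⟫) x (v x) := by
    rw [fderiv_fun_sum fun i _ => (differentiableAt_const _).inner ℝ (hdi i),
      _root_.FunLike.coe_sum, Finset.sum_apply]
    refine Finset.sum_congr rfl fun i _ => ?_
    rw [fderiv_inner_apply ℝ (differentiableAt_const _) (hdi i), fderiv_fun_const]
    simp
  have h3 : fderiv ℝ (fun y => ∑ i, ⟪b i, fderiv ℝ v y (b i)⟫) x = 0 := by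
    have hev : (fun y => ∑ i, ⟪b i, fderiv ℝ v y (b i)⟫) =ᶠ[𝓝 x] fun _ => (0 : ℝ) := by
      filter_upwards [hU.mem_nhds hx] with y hy
      rw [← divergence_eq_sum_inner_fderiv b, hdiv y hy]
    rw [hev.fderiv_eq, fderiv_fun_const]
    rfl
  rw [divergence_eq_sum_inner_fderiv b, LinearMap.trace_eq_sum_inner _ b]
  simp only [h1, inner_add_right, Finset.sum_add_distrib, h2, h3, zero_apply,
    add_zero]
  rfl

end Calculus

/-! ### Slices of jointly smooth fields: derivatives within the closed cylinder -/

section Slices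

variable {X : Type*} [NormedAddCommGroup X] [NormedSpace ℝ X]
variable {F' : Type*} [NormedAddCommGroup F'] [NormedSpace ℝ F']
variable {S : Set ℝ} {K : Set X} {w : ℝ → X → F'} {n : WithTop ℕ∞}

/-- **The derivative within `K` of a slice is the spatial part of the joint derivative within
`S × K`**: `D(w s)|_K (x) = D(uncurry w)|_{S × K}(s, x) ∘ inr` at points of unique
differentiability of `K`. [folklore] -/
theorem fderivWithin_slice_eq_comp_inr (h : ContDiffOn ℝ n (uncurry w) (S ×ˢ K)) (hn : n ≠ 0)
    {s : ℝ} (hs : s ∈ S) {x : X} (hx : x ∈ K) (hK : UniqueDiffWithinAt ℝ K x) :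
    fderivWithin ℝ (w s) K x =
      (fderivWithin ℝ (uncurry w) (S ×ˢ K) (s, x)).comp (ContinuousLinearMap.inr ℝ ℝ X) := by
  have h1 := hasFDerivWithinAt_uncurry_of_contDiffOn_prod h hn hs hx
  have h2 : HasFDerivWithinAt (fun y : X => ((s, y) : ℝ × X)) (ContinuousLinearMap.inr ℝ ℝ X) K x :=
    (hasFDerivAt_prodMk_right s x).hasFDerivWithinAt
  exact (h1.comp x h2 fun y hy => ⟨hs, hy⟩).fderivWithin hK

end Slices

section CylinderSlices

variable {F' : Type*} [NormedAddCommGroup F'] [NormedSpace ℝ F']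
variable {S : Set ℝ} {w : ℝ → ℝ³ → F'}

/-- On the closed cylinder, the derivative within of a slice along a constant direction is the
slice of the joint field `spaceDerivWithin`. [folklore] -/
theorem cylDeriv_slice_eqOn_spaceDerivWithin (h : ContDiffOn ℝ ∞ (uncurry w) (S ×ˢ 𝕂)) {s : ℝ}
    (hs : s ∈ S) (v : ℝ³) :
    EqOn (cylDeriv (fun _ => v) (w s)) (spaceDerivWithin S 𝕂 v w s) 𝕂 := by
  intro x hx
  rw [cylDeriv_apply, spaceDerivWithin_apply,
    fderivWithin_slice_eq_comp_inr h (by simp) hs hx (uniqueDiffOn_K x hx)]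
  rfl

/-- The derivative within the closed cylinder of the slices along a constant direction is again
(on `S × 𝕂`) a jointly smooth field: it agrees there with `spaceDerivWithin S 𝕂 v w`. [folklore] -/
theorem exists_contDiffOn_uncurry_cylDeriv_slice (hS : UniqueDiffOn ℝ S)
    (h : ContDiffOn ℝ ∞ (uncurry w) (S ×ˢ 𝕂)) (v : ℝ³) :
    ContDiffOn ℝ ∞ (uncurry (spaceDerivWithin S 𝕂 v w)) (S ×ˢ 𝕂) ∧
      ∀ s ∈ S, EqOn (cylDeriv (fun _ => v) (w s)) (spaceDerivWithin S 𝕂 v w s) 𝕂 :=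
  ⟨contDiffOn_uncurry_spaceDerivWithin hS uniqueDiffOn_K h v,
    fun _ hs => cylDeriv_slice_eqOn_spaceDerivWithin h hs v⟩

/-- **Joint continuity of `(s, x) ↦ Δ_K (w s) (x)` on `S × 𝕂`** for a jointly smooth field: the
Laplacian within of the slices is the sum of the second joint spatial derivatives
`spaceDerivWithin S 𝕂 eᵢ (spaceDerivWithin S 𝕂 eᵢ w)`. [folklore] -/
theorem continuousOn_uncurry_cylLap_slice (hS : UniqueDiffOn ℝ S)
    (h : ContDiffOn ℝ ∞ (uncurry w) (S ×ˢ 𝕂)) :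
    ContinuousOn (fun z : ℝ × ℝ³ => cylLap (w z.1) z.2) (S ×ˢ 𝕂) := by
  -- the second joint spatial derivatives
  set W₁ : Fin 3 → ℝ → ℝ³ → F' := fun i => spaceDerivWithin S 𝕂 (cylBasis i) w with hW₁
  set W₂ : Fin 3 → ℝ → ℝ³ → F' := fun i => spaceDerivWithin S 𝕂 (cylBasis i) (W₁ i) with hW₂
  have hW₁ : ∀ i, ContDiffOn ℝ ∞ (uncurry (W₁ i)) (S ×ˢ 𝕂) := fun i =>
    contDiffOn_uncurry_spaceDerivWithin hS uniqueDiffOn_K h (cylBasis i)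
  have hW₂ : ∀ i, ContDiffOn ℝ ∞ (uncurry (W₂ i)) (S ×ˢ 𝕂) := fun i =>
    contDiffOn_uncurry_spaceDerivWithin hS uniqueDiffOn_K (hW₁ i) (cylBasis i)
  have heq : ∀ z ∈ S ×ˢ 𝕂, cylLap (w z.1) z.2 = ∑ i, uncurry (W₂ i) z := by
    rintro ⟨s, x⟩ ⟨hs, hx⟩
    rw [cylLap_apply]
    refine Finset.sum_congr rfl fun i _ => ?_
    have e1 : EqOn (cylDeriv (fun _ => cylBasis i) (w s)) (W₁ i s) 𝕂 :=
      cylDeriv_slice_eqOn_spaceDerivWithin h hs (cylBasis i)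
    show cylDeriv (fun _ => cylBasis i) (cylDeriv (fun _ => cylBasis i) (w s)) x = W₂ i s x
    rw [cylDeriv_congr e1 hx]
    exact cylDeriv_slice_eqOn_spaceDerivWithin (hW₁ i) hs (cylBasis i) hx
  refine ContinuousOn.congr (continuousOn_finsetSum _ fun i _ => (hW₂ i).continuousOn) heq

end CylinderSlices

/-! ### The pressure Poisson equation (10) -/

namespace IsPeriodicCylinderEulerSolution

variable {L T : ℝ} {u₀ : ℝ³ → ℝ³} {u : ℝ → ℝ³ → ℝ³} {p : ℝ → ℝ³ → ℝ}

/-- **`div ∂ₜu = 0` in the open cylinder at interior times**: `∂ⱼ ∂ₜu = ∂ₜ ∂ⱼu`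
(`timeDerivWithin_spaceDerivWithin`), so `div ∂ₜu(t, x) = ∂ₜ (div u(·, x))(t) = 0`, the function
`s ↦ div u(s, x)` vanishing on `[0, T)`. [folklore] -/
theorem divergence_timeDerivWithin_eq_zero (h : IsPeriodicCylinderEulerSolution L (Ico 0 T) u₀ u p)
    {t : ℝ} (ht : t ∈ Ioo 0 T) {x : ℝ³} (hx : x ∈ (unitCylinder : Set ℝ³)) :
    VectorCalculus.divergence (timeDerivWithin (Ico 0 T) u t) x = 0 := by
  set S : Set ℝ := Ico 0 T with hS_def
  set b := EuclideanSpace.basisFun (Fin 3) ℝ with hb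
  have hS : UniqueDiffOn ℝ S := uniqueDiffOn_Ico 0 T
  have htS : t ∈ S := Ioo_subset_Ico_self ht
  have hSt : S ∈ 𝓝 t := mem_of_superset (Ioo_mem_nhds ht.1 ht.2) Ioo_subset_Ico_self
  have hxK : x ∈ 𝕂 := subset_closure hx
  have hKx : 𝕂 ∈ 𝓝 x := closure_unitCylinder_mem_nhds hx
  have hu : ContDiffOn ℝ ∞ (uncurry u) (S ×ˢ 𝕂) := h.smooth_velocity
  -- the joint spatial derivatives
  set W : Fin 3 → ℝ → ℝ³ → ℝ³ := fun i => spaceDerivWithin S 𝕂 (b i) u with hW_def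
  have hW : ∀ i, ContDiffOn ℝ ∞ (uncurry (W i)) (S ×ˢ 𝕂) := fun i =>
    contDiffOn_uncurry_spaceDerivWithin hS uniqueDiffOn_K hu (b i)
  have h1 : ∀ i, fderiv ℝ (timeDerivWithin S u t) x (b i) = timeDerivWithin S (W i) t x :=
    fun i => (timeDerivWithin_spaceDerivWithin hS hu htS hSt hxK hKx (b i)).symm
  -- time differentiability of the slices in `t` at `x`
  have hd : ∀ i, HasDerivWithinAt (fun s => W i s x) (timeDerivWithin S (W i) t x) S t := by
    intro i
    rw [timeDerivWithin_eq_fderivWithin_uncurry (hW i) (by simp) hS htS hxK]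
    exact hasDerivWithinAt_time_fderivWithin (hW i) (by simp) htS hxK
  have hsum : HasDerivWithinAt (fun s => ∑ i, ⟪b i, W i s x⟫)
      (∑ i, ⟪b i, timeDerivWithin S (W i) t x⟫) S t := by
    refine HasDerivWithinAt.fun_sum fun i _ => ?_
    have := (hasDerivWithinAt_const t S (b i)).inner ℝ (hd i)
    simpa using this
  -- the function `s ↦ Σᵢ ⟪eᵢ, ∂ᵢu(s, x)⟫ = div u(s, x)` vanishes on `S`
  have hzero : ∀ s ∈ S, ∑ i, ⟪b i, W i s x⟫ = 0 := by
    intro s hs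
    have e : ∀ i, W i s x = fderiv ℝ (u s) x (b i) := fun i =>
      spaceDerivWithin_apply_eq_fderiv hu (by simp) hs hxK hKx (b i)
    simp only [e]
    rw [← divergence_eq_sum_inner_fderiv b]
    exact h.euler.divFree s hs x hx
  have hzero' : HasDerivWithinAt (fun s => ∑ i, ⟪b i, W i s x⟫) 0 S t :=
    (hasDerivWithinAt_const t S (0 : ℝ)).congr_of_mem (fun s hs => hzero s hs) htS
  rw [divergence_eq_sum_inner_fderiv b]
  simp only [h1]
  exact (hS t htS).eq_deriv _ hsum hzero'

/-- **The pressure Poisson equation in the open cylinder at interior times**: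
`Δp(t)(x) = −tr(Du(t)(x) ∘ Du(t)(x))` for `0 < t < T`, `r(x) < 1` (take the divergence of the
momentum equation `∇p = −∂ₜu − (u·∇)u`: `div ∂ₜu = 0`, `div((u·∇)u) = tr(Du ∘ Du)`; Ferrari 1993,
(10)). [cite: Ferrari1993, (10) p. 281] -/
theorem laplacian_pressure_eq_of_mem_Ioo (h : IsPeriodicCylinderEulerSolution L (Ico 0 T) u₀ u p)
    {t : ℝ} (ht : t ∈ Ioo 0 T) {x : ℝ³} (hx : x ∈ (unitCylinder : Set ℝ³)) :
    (Δ (p t)) x =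
      -LinearMap.trace ℝ ℝ³ ((fderiv ℝ (u t) x).comp (fderiv ℝ (u t) x) : ℝ³ →ₗ[ℝ] ℝ³) := by
  set S : Set ℝ := Ico 0 T with hS_def
  have hS : UniqueDiffOn ℝ S := uniqueDiffOn_Ico 0 T
  have htS : t ∈ S := Ioo_subset_Ico_self ht
  have hU : IsOpen (unitCylinder : Set ℝ³) := unitCylinder.isOpen
  have hxK : x ∈ 𝕂 := subset_closure hx
  have hKx : 𝕂 ∈ 𝓝 x := closure_unitCylinder_mem_nhds hx
  have hu : ContDiffOn ℝ ∞ (uncurry u) (S ×ˢ 𝕂) := h.smooth_velocity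
  have hus : ContDiffOn ℝ ∞ (u t) (unitCylinder : Set ℝ³) :=
    (contDiffOn_slice_of_contDiffOn_uncurry hu htS).mono subset_closure
  have hps : ContDiffOn ℝ ∞ (p t) 𝕂 := contDiffOn_slice_of_contDiffOn_uncurry h.smooth_pressure htS
  -- `Δp = div ∇p`
  rw [laplacian_eq_cylLap hps hx, ← divergence_gradient_eq_cylLap hps hx]
  -- the momentum equation near `x`
  have hmom : gradient (p t) =ᶠ[𝓝 x]
      fun y => -(timeDerivWithin S u t y + convect (u t) (u t) y) := by
    filter_upwards [hU.mem_nhds hx] with y hy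
    have hm := h.euler.momentum t htS y hy
    simp only [Pi.zero_apply, add_zero] at hm
    exact (neg_eq_iff_eq_neg.mpr hm).symm
  have hcongr : VectorCalculus.divergence (gradient (p t)) x =
      VectorCalculus.divergence (fun y => -(timeDerivWithin S u t y + convect (u t) (u t) y)) x := by
    unfold VectorCalculus.divergence
    rw [hmom.fderiv_eq]
  -- differentiability of the two terms at `x`
  have dC : DifferentiableAt ℝ (convect (u t) (u t)) x :=
    differentiableAt_of_contDiffOn_isOpen hU (contDiffOn_convect_of_isOpen hU hus) hx
  have dT : DifferentiableAt ℝ (timeDerivWithin S u t) x := by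
    -- `∂ₜu` is, on `𝕂`, the slice of the jointly smooth field `(s, y) ↦ D(s, y)(1, 0)`
    set G : ℝ → ℝ³ → ℝ³ := fun s y => fderivWithin ℝ (uncurry u) (S ×ˢ 𝕂) (s, y) ((1 : ℝ), (0 : ℝ³))
      with hG_def
    have hG : ContDiffOn ℝ ∞ (uncurry G) (S ×ˢ 𝕂) := by
      have hD : ContDiffOn ℝ ∞
          (fun z : ℝ × ℝ³ => fderivWithin ℝ (uncurry u) (S ×ˢ 𝕂) z ((1 : ℝ), (0 : ℝ³))) (S ×ˢ 𝕂) :=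
        (hu.fderivWithin (hS.prod uniqueDiffOn_K) (by simp)).clm_apply contDiffOn_const
      refine hD.congr ?_
      rintro ⟨s, y⟩ _
      rfl
    have hGt : ContDiffOn ℝ ∞ (G t) 𝕂 := contDiffOn_slice_of_contDiffOn_uncurry hG htS
    have hGd : DifferentiableAt ℝ (G t) x :=
      ((hGt.differentiableOn (by simp)) x hxK).differentiableAt hKx
    refine hGd.congr_of_eventuallyEq ?_
    filter_upwards [hKx] with y hy
    exact timeDerivWithin_eq_fderivWithin_uncurry hu (by simp) hS htS hy
  have hlin : VectorCalculus.divergence (fun y => -(timeDerivWithin S u t y + convect (u t) (u t) y)) x =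
      -(VectorCalculus.divergence (timeDerivWithin S u t) x +
        VectorCalculus.divergence (convect (u t) (u t)) x) := by
    simp only [VectorCalculus.divergence, fderiv_fun_neg, fderiv_fun_add dT dC,
      ContinuousLinearMap.toLinearMap_neg, ContinuousLinearMap.toLinearMap_add, map_neg, map_add]
  rw [hcongr, hlin, h.divergence_timeDerivWithin_eq_zero ht hx, zero_add,
    divergence_convect_self_eq_trace hU hus (fun y hy => h.euler.divFree t htS y hy) hx]

/-- **The pressure Poisson equation up to the wall, (10)**: for every `t ∈ [0, T)` and every `x`
of the closed cylinder `{r ≤ 1}`,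
`Δ_K p(t) (x) = −tr(D_K u(t)(x) ∘ D_K u(t)(x))` (`= −Σᵢⱼ ∂ᵢuⱼ ∂ⱼuᵢ`), the Laplacian and the
derivatives being taken within the closed cylinder. Both sides are continuous on
`[0, T) × {r ≤ 1} ⊆ closure((0, T) × {r < 1})` and agree on `(0, T) × {r < 1}`
(`laplacian_pressure_eq_of_mem_Ioo`). [cite: Ferrari1993, (10) p. 281] -/
theorem cylLap_pressure_eq (h : IsPeriodicCylinderEulerSolution L (Ico 0 T) u₀ u p)
    {t : ℝ} (ht : t ∈ Ico 0 T) {x : ℝ³} (hx : x ∈ 𝕂) :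
    cylLap (p t) x =
      -LinearMap.trace ℝ ℝ³
        ((fderivWithin ℝ (u t) 𝕂 x).comp (fderivWithin ℝ (u t) 𝕂 x) : ℝ³ →ₗ[ℝ] ℝ³) := by
  set S : Set ℝ := Ico 0 T with hS_def
  set b := stdOrthonormalBasis ℝ ℝ³ with hb
  have hT : 0 < T := ht.1.trans_lt ht.2
  have hS : UniqueDiffOn ℝ S := uniqueDiffOn_Ico 0 T
  have hU : IsOpen (unitCylinder : Set ℝ³) := unitCylinder.isOpen
  have hu : ContDiffOn ℝ ∞ (uncurry u) (S ×ˢ 𝕂) := h.smooth_velocity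
  have hp : ContDiffOn ℝ ∞ (uncurry p) (S ×ˢ 𝕂) := h.smooth_pressure
  -- the joint spatial derivative within `S × 𝕂`, and the slice derivatives within `𝕂`
  set D : ℝ × ℝ³ → ℝ³ →L[ℝ] ℝ³ := fun z =>
    (fderivWithin ℝ (uncurry u) (S ×ˢ 𝕂) z).comp (ContinuousLinearMap.inr ℝ ℝ ℝ³) with hD_def
  have hDc : ContinuousOn D (S ×ˢ 𝕂) :=
    (hu.continuousOn_fderivWithin (hS.prod uniqueDiffOn_K) (by simp)).clm_comp continuousOn_const
  have hDeq : ∀ z ∈ S ×ˢ 𝕂, fderivWithin ℝ (u z.1) 𝕂 z.2 = D z := by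
    rintro ⟨s, y⟩ ⟨hs, hy⟩
    exact fderivWithin_slice_eq_comp_inr hu (by simp) hs hy (uniqueDiffOn_K y hy)
  -- the two sides as functions on `S × 𝕂`
  set F₁ : ℝ × ℝ³ → ℝ := fun z => cylLap (p z.1) z.2 with hF₁
  set F₂ : ℝ × ℝ³ → ℝ := fun z => -∑ i, ⟪b i, D z (D z (b i))⟫ with hF₂
  have hF₁c : ContinuousOn F₁ (S ×ˢ 𝕂) := continuousOn_uncurry_cylLap_slice hS hp
  have hF₂c : ContinuousOn F₂ (S ×ˢ 𝕂) := by
    refine ContinuousOn.neg (continuousOn_finsetSum _ fun i _ => ?_)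
    exact continuousOn_const.inner ((hDc.clm_apply (hDc.clm_apply continuousOn_const)))
  -- they agree on `(0, T) × {r < 1}`
  have hagree : EqOn F₁ F₂ (Ioo 0 T ×ˢ (unitCylinder : Set ℝ³)) := by
    rintro ⟨s, y⟩ ⟨hs, hy⟩
    have hsS : s ∈ S := Ioo_subset_Ico_self hs
    have hyK : y ∈ 𝕂 := subset_closure hy
    have hps : ContDiffOn ℝ ∞ (p s) 𝕂 := contDiffOn_slice_of_contDiffOn_uncurry hp hsS
    have key := h.laplacian_pressure_eq_of_mem_Ioo hs hy
    rw [laplacian_eq_cylLap hps hy, LinearMap.trace_eq_sum_inner _ b] at key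
    have hDy : fderiv ℝ (u s) y = D (s, y) := by
      rw [← fderivWithin_of_mem_nhds (closure_unitCylinder_mem_nhds hy)]
      exact hDeq (s, y) ⟨hsS, hyK⟩
    simp only [hF₁, hF₂]
    rw [key, hDy]
    rfl
  -- and `S × 𝕂 ⊆ closure((0, T) × {r < 1})`
  have hsub : Ioo 0 T ×ˢ (unitCylinder : Set ℝ³) ⊆ S ×ˢ 𝕂 :=
    prod_mono Ioo_subset_Ico_self subset_closure
  have hcl : S ×ˢ 𝕂 ⊆ closure (Ioo 0 T ×ˢ (unitCylinder : Set ℝ³)) := by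
    rw [closure_prod_eq, closure_Ioo hT.ne]
    exact prod_mono Ico_subset_Icc_self Subset.rfl
  have hEq := hagree.of_subset_closure hF₁c hF₂c hsub hcl
  have e := hEq (x := (t, x)) ⟨ht, hx⟩
  simp only [hF₁, hF₂] at e
  rw [e, LinearMap.trace_eq_sum_inner _ b, hDeq (t, x) ⟨ht, hx⟩]
  rfl

/-- **The pressure Poisson equation in the open cylinder, classical form**: for every `t ∈ [0, T)`
and `r(x) < 1`, `Δp(t)(x) = −tr(Du(t)(x) ∘ Du(t)(x))` with Mathlib's Laplacian and Fréchet
derivative (Ferrari 1993, (10): `Δp = −Σ_{i,j} ∂ᵢuⱼ ∂ⱼuᵢ`). [cite: Ferrari1993, (10) p. 281] -/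
theorem laplacian_pressure_eq (h : IsPeriodicCylinderEulerSolution L (Ico 0 T) u₀ u p)
    {t : ℝ} (ht : t ∈ Ico 0 T) {x : ℝ³} (hx : x ∈ (unitCylinder : Set ℝ³)) :
    (Δ (p t)) x =
      -LinearMap.trace ℝ ℝ³ ((fderiv ℝ (u t) x).comp (fderiv ℝ (u t) x) : ℝ³ →ₗ[ℝ] ℝ³) := by
  have hps : ContDiffOn ℝ ∞ (p t) 𝕂 := contDiffOn_slice_of_contDiffOn_uncurry h.smooth_pressure ht
  rw [laplacian_eq_cylLap hps hx, h.cylLap_pressure_eq ht (subset_closure hx),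
    fderivWithin_of_mem_nhds (closure_unitCylinder_mem_nhds hx)]

/-! ### The Neumann boundary condition (11)–(12) -/

/-- **The momentum equation holds up to the wall**: for `t ∈ [0, T)` and every `x` of the closed
cylinder, `∂ₜu(t, x) + D_K u(t)(x)(u(t, x)) + ∇_K p(t)(x) = 0`, derivatives within the closed
cylinder (all three terms are continuous on `{r ≤ 1} = closure {r < 1}` and the identity holds in
`{r < 1}`). [folklore] -/
theorem momentum_closure (h : IsPeriodicCylinderEulerSolution L (Ico 0 T) u₀ u p)
    {t : ℝ} (ht : t ∈ Ico 0 T) {x : ℝ³} (hx : x ∈ 𝕂) :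
    timeDerivWithin (Ico 0 T) u t x + fderivWithin ℝ (u t) 𝕂 x (u t x) + cylGrad (p t) x = 0 := by
  set S : Set ℝ := Ico 0 T with hS_def
  have hS : UniqueDiffOn ℝ S := uniqueDiffOn_Ico 0 T
  have hu : ContDiffOn ℝ ∞ (uncurry u) (S ×ˢ 𝕂) := h.smooth_velocity
  have hus : ContDiffOn ℝ ∞ (u t) 𝕂 := contDiffOn_slice_of_contDiffOn_uncurry hu ht
  have hps : ContDiffOn ℝ ∞ (p t) 𝕂 := contDiffOn_slice_of_contDiffOn_uncurry h.smooth_pressure ht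
  set A : ℝ³ → ℝ³ := fun y =>
    timeDerivWithin S u t y + fderivWithin ℝ (u t) 𝕂 y (u t y) + cylGrad (p t) y with hA
  -- continuity on the closed cylinder
  have cT : ContinuousOn (timeDerivWithin S u t) 𝕂 := by
    have c := continuousOn_uncurry_timeDerivWithin (hu.of_le (by exact_mod_cast le_top)) le_rfl hS
      uniqueDiffOn_K (n := 1)
    exact c.comp (f := fun y : ℝ³ => ((t, y) : ℝ × ℝ³)) (continuous_const.prodMk continuous_id).continuousOn
      fun y hy => ⟨ht, hy⟩
  have cC : ContinuousOn (fun y => fderivWithin ℝ (u t) 𝕂 y (u t y)) 𝕂 :=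
    (hus.continuousOn_fderivWithin uniqueDiffOn_K (by simp)).clm_apply hus.continuousOn
  have cG : ContinuousOn (cylGrad (p t)) 𝕂 := (contDiffOn_cylGrad hps).continuousOn
  have cA : ContinuousOn A 𝕂 := (cT.add cC).add cG
  -- the identity in the open cylinder
  have hA0 : EqOn A (fun _ => 0) (unitCylinder : Set ℝ³) := by
    intro y hy
    have hm := h.euler.momentum t ht y hy
    simp only [Pi.zero_apply, add_zero, convect_apply] at hm
    simp only [hA, fderivWithin_of_mem_nhds (closure_unitCylinder_mem_nhds hy), cylGrad_eq_gradient _ hy,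
      hm, neg_add_cancel]
  have key := hA0.of_subset_closure cA continuousOn_const subset_closure Subset.rfl
  exact key hx

/-- **On the wall the time derivative is tangential**: `⟪∂ₜu(t, x), e_r(x)⟫ = ∂ₜ⟪u(·, x), e_r(x)⟫ = 0`
for `r(x) = 1`, by the slip condition at all times of `[0, T)`. [folklore] -/
theorem inner_timeDerivWithin_eR_eq_zero (h : IsPeriodicCylinderEulerSolution L (Ico 0 T) u₀ u p)
    {t : ℝ} (ht : t ∈ Ico 0 T) {x : ℝ³} (hx : x ∈ frontier (unitCylinder : Set ℝ³)) :
    ⟪timeDerivWithin (Ico 0 T) u t x, eR x⟫ = 0 := by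
  set S : Set ℝ := Ico 0 T with hS_def
  have hS : UniqueDiffOn ℝ S := uniqueDiffOn_Ico 0 T
  have hu : ContDiffOn ℝ ∞ (uncurry u) (S ×ˢ 𝕂) := h.smooth_velocity
  have hxK : x ∈ 𝕂 := frontier_subset_closure hx
  have hd : HasDerivWithinAt (fun s => u s x) (timeDerivWithin S u t x) S t := by
    rw [timeDerivWithin_eq_fderivWithin_uncurry hu (by simp) hS ht hxK]
    exact hasDerivWithinAt_time_fderivWithin hu (by simp) ht hxK
  have h1 : HasDerivWithinAt (fun s => ⟪u s x, eR x⟫) ⟪timeDerivWithin S u t x, eR x⟫ S t := by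
    have := hd.inner ℝ (hasDerivWithinAt_const t S (eR x))
    simpa using this
  have h2 : HasDerivWithinAt (fun s => ⟪u s x, eR x⟫) 0 S t :=
    (hasDerivWithinAt_const t S (0 : ℝ)).congr_of_mem (fun s hs => h.euler.slip s hs x hx) ht
  exact (hS t ht).eq_deriv _ h1 h2

end IsPeriodicCylinderEulerSolution

/-- On the wall `{r = 1}` the radial unit vector is the horizontal position: `e_r(x) = (x₀, x₁, 0)`.
[folklore] -/
theorem eR_eq_horizontalProj_of_mem_frontier {x : ℝ³} (hx : x ∈ frontier (unitCylinder : Set ℝ³)) :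
    eR x = horizontalProj x := by
  rw [frontier_unitCylinder] at hx
  have hr : cylRadius x = 1 := hx
  rw [eR, hr, inv_one, one_smul, horizontalProj_apply_eq]

/-- `⟪w, w_h⟫ = w₀² + w₁²`. [folklore] -/
theorem inner_horizontalProj_self (w : ℝ³) : ⟪w, horizontalProj w⟫ = w 0 ^ 2 + w 1 ^ 2 := by
  rw [horizontalProj_eq_add_cylBasis, inner_add_right, inner_smul_right, inner_smul_right,
    inner_cylBasis_right, inner_cylBasis_right]
  ring

/-- A vector tangential on the wall is a combination of the rotation generator and the axial
direction: if `r(x) = 1` and `⟪w, e_r(x)⟫ = 0` then `w = ⟪w, J x⟫ J x + w₂ e₂`. [folklore] -/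
theorem eq_rotGen_add_axial_of_inner_eR_eq_zero {x : ℝ³} (hx : x ∈ frontier (unitCylinder : Set ℝ³))
    {w : ℝ³} (hw : ⟪w, eR x⟫ = 0) : w = ⟪w, rotGen x⟫ • rotGen x + w 2 • cylBasis 2 := by
  have hx' := hx
  rw [frontier_unitCylinder] at hx'
  have hr : cylRadius x = 1 := hx'
  have hr2 : x 0 ^ 2 + x 1 ^ 2 = 1 := by rw [← cylRadius_sq, hr]; norm_num
  rw [eR_eq_horizontalProj_of_mem_frontier hx, horizontalProj_eq_add_cylBasis, inner_add_right,
    inner_smul_right, inner_smul_right, inner_cylBasis_right, inner_cylBasis_right] at hw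
  have hJ : ⟪w, rotGen x⟫ = x 0 * w 1 - x 1 * w 0 := by rw [real_inner_comm, inner_rotGen_left]
  rw [hJ]
  ext i
  fin_cases i
  · simp [rotGen, cylBasis_apply]
    linear_combination (x 0) * hw + (-(w 0)) * hr2
  · simp [rotGen, cylBasis_apply]
    linear_combination (x 1) * hw + (-(w 1)) * hr2
  · simp [rotGen, cylBasis_apply]

/-- **`⟪D_K v (v), e_r⟫ = −(v₀² + v₁²)` on the wall for a tangential field** (the elimination of the
derivative of `u` in (11) ⇒ (12), Ferrari 1993 p. 281, for the cylinder, where `∂Ω = {φ = 0}` with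
`φ = (x₀² + x₁² − 1)/2`, `|∇φ| = 1` and `∂ᵢ∂ⱼφ = δᵢⱼ` (`i, j ≤ 1`) on the wall): the function
`⟪v, x_h⟫` vanishes on the wall and `v(x)` is tangent there, so `∂_{v(x)} ⟪v, x_h⟫ (x) = 0`
(`cylDeriv_eq_zero_of_wall_of_tangent`), i.e. `⟪D_K v(x)(v x), x_h⟫ + ⟪v x, (v x)_h⟫ = 0`, and
`x_h = e_r(x)`, `⟪v, v_h⟫ = v₀² + v₁²`. [cite: Ferrari1993, (11)–(12) p. 281] -/
theorem inner_fderivWithin_apply_self_eR {v : ℝ³ → ℝ³} (hv : ContDiffOn ℝ ∞ v 𝕂)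
    (hslip : ∀ y ∈ frontier (unitCylinder : Set ℝ³), ⟪v y, eR y⟫ = 0) {x : ℝ³}
    (hx : x ∈ frontier (unitCylinder : Set ℝ³)) :
    ⟪fderivWithin ℝ v 𝕂 x (v x), eR x⟫ = -(v x 0 ^ 2 + v x 1 ^ 2) := by
  have hxK : x ∈ 𝕂 := frontier_subset_closure hx
  set g : ℝ³ → ℝ := fun y => ⟪v y, horizontalProj y⟫ with hg_def
  have hg : ContDiffOn ℝ ∞ g 𝕂 := hv.inner ℝ contDiff_horizontalProj.contDiffOn
  have hg0 : ∀ y ∈ frontier (unitCylinder : Set ℝ³), g y = 0 := fun y hy => by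
    simp only [hg_def, ← eR_eq_horizontalProj_of_mem_frontier hy, hslip y hy]
  have htan := eq_rotGen_add_axial_of_inner_eR_eq_zero hx (hslip x hx)
  have key := cylDeriv_eq_zero_of_wall_of_tangent (V := v) hg hg0 hx htan
  rw [hg_def, cylDeriv_inner hv contDiff_horizontalProj.contDiffOn hxK] at key
  have hD : cylDeriv v (fun y => horizontalProj y) x = horizontalProj (v x) := by
    rw [cylDeriv_eq_fderiv_of_differentiableAt (W := fun y => horizontalProj y)
      horizontalProjL.differentiableAt hxK, fderiv_horizontalProj]
    rfl
  rw [hD, cylDeriv_apply, ← eR_eq_horizontalProj_of_mem_frontier hx, inner_horizontalProj_self] at key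
  linarith

namespace IsPeriodicCylinderEulerSolution

variable {L T : ℝ} {u₀ : ℝ³ → ℝ³} {u : ℝ → ℝ³ → ℝ³} {p : ℝ → ℝ³ → ℝ}

/-- **The Neumann boundary condition for the pressure, (11)–(12)**: for every `t ∈ [0, T)` and every
`x` of the wall `{r = 1}`, the outward normal derivative of the pressure (the derivative within the
closed cylinder along `e_r`) is
`∂p(t)/∂n (x) = u₀(t, x)² + u₁(t, x)²`
(Ferrari 1993, p. 281: (11) `∂p/∂n = −Σ uᵢ(∂ᵢuⱼ)nⱼ`, obtained as "the dot product of (1) with `n`"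
using (3), and (12) `∂p/∂n = −Σ uᵢuⱼψᵢⱼ`; for the cylinder `−Σ uᵢuⱼψᵢⱼ = u₀² + u₁²` with the outward
normal). Proof: take `⟪·, e_r⟫` of `momentum_closure`; `⟪∂ₜu, e_r⟫ = 0`
(`inner_timeDerivWithin_eR_eq_zero`) and `⟪D_K u (u), e_r⟫ = −(u₀² + u₁²)`
(`inner_fderivWithin_apply_self_eR`). [cite: Ferrari1993, (11)–(12) p. 281] -/
theorem neumann_pressure_eq (h : IsPeriodicCylinderEulerSolution L (Ico 0 T) u₀ u p)
    {t : ℝ} (ht : t ∈ Ico 0 T) {x : ℝ³} (hx : x ∈ frontier (unitCylinder : Set ℝ³)) :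
    fderivWithin ℝ (p t) 𝕂 x (eR x) = u t x 0 ^ 2 + u t x 1 ^ 2 := by
  have hxK : x ∈ 𝕂 := frontier_subset_closure hx
  have hus : ContDiffOn ℝ ∞ (u t) 𝕂 := contDiffOn_slice_of_contDiffOn_uncurry h.smooth_velocity ht
  have hm := h.momentum_closure ht hxK
  have hC : cylGrad (p t) x =
      -(timeDerivWithin (Ico 0 T) u t x + fderivWithin ℝ (u t) 𝕂 x (u t x)) :=
    eq_neg_of_add_eq_zero_right hm
  rw [← inner_cylGrad_left, hC, inner_neg_left, inner_add_left, h.inner_timeDerivWithin_eR_eq_zero ht hx,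
    inner_fderivWithin_apply_self_eR hus (fun y hy => h.euler.slip t ht y hy) hx]
  ring

/-- The Neumann datum `u₀² + u₁²` of the pressure is smooth on the closed cylinder and `L`-periodic
(the form in which the Neumann estimate consumes it). [folklore] -/
theorem contDiffOn_neumannDatum (h : IsPeriodicCylinderEulerSolution L (Ico 0 T) u₀ u p)
    {t : ℝ} (ht : t ∈ Ico 0 T) :
    ContDiffOn ℝ ∞ (fun y => u t y 0 ^ 2 + u t y 1 ^ 2) 𝕂 ∧
      IsAxiallyPeriodic L (fun y => u t y 0 ^ 2 + u t y 1 ^ 2) := by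
  have hus : ContDiffOn ℝ ∞ (u t) 𝕂 := contDiffOn_slice_of_contDiffOn_uncurry h.smooth_velocity ht
  refine ⟨?_, fun y => by simp only [(h.periodic t ht).1 y]⟩
  have hc : ∀ i : Fin 3, ContDiffOn ℝ ∞ (fun y => u t y i) 𝕂 := fun i =>
    (EuclideanSpace.proj (𝕜 := ℝ) i).contDiff.comp_contDiffOn hus
  exact ((hc 0).pow 2).add ((hc 1).pow 2)

end IsPeriodicCylinderEulerSolution

end Literature.Analysis.FluidPDE
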